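import Literature.NumberTheory.IwasawaTheory.CyclotomicColemanMap
import Literature.NumberTheory.IwasawaTheory.CyclotomicUnitRegulator
import HarnessLib

/-!
# Sinnott's norm elements `N_{ℚ(μ_t)/ℚ(μ_t)∩k}(1 − ζ_t^a)` are GLOBAL UNITS of `k` for `t` not a prime power:
# they lie in `k` (Galois descent in `ℚ̄`), are algebraic integers, and are invertible in the algebraic integers
# (`Φ_t(1) = 1`) — THEOREMS (no named fact)

Topic `Literature/NumberTheory/IwasawaTheory` (namespace = path; sub-namespace `CyclotomicUnits` as in
`CyclotomicColemanMap.lean` §1, whose choice-free `sinnottNorm k ζ a = ∏ᶠ_{b ∈ sinnottExponents k ζ} (1 − ζ^{ab})` this file is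
about).  Cell bsd-cm, seat bsd-cm-k-ty1 g24 (row GENUS-PORT-A2): the input «the Sinnott family `ξ_n = N(1 − ζ_{7^{n+1}|D|})`
IS a family of global units of `K_n` with the pinned value» of the `𝒞₇` genus road's K1ᵘ witness (`GenusDatum.ξu`,
`ξu_val`) DISCHARGED in general.  THEOREMS ONLY (no `def`, no fact, no `instance`, no notation); nothing about elliptic
curves or BSD.

## The print and what is proved

Tsuji, J. Number Theory 78 (1999) §6 p. 20: «`D_k` denotes the subgroup of `k^×` generated by
`{±1, N_{ℚ(μ_t)/ℚ(μ_t)∩k}(1 − ζ_t^a) | t, a ∈ ℤ, t > 1, (a,t) = 1}` … `C_k = D_k ∩ E_k`»; Lang, *Cyclotomic Fields I–II* Ch. 3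
§5 / Washington Prop. 2.8: for `t` with at least two distinct prime factors `1 − ζ_t` is a unit of `ℤ[ζ_t]` (`Φ_t(1) = 1`).
* §1 `sinnottExponents k ζ` is closed under multiplication and, for `τ ∈ Gal(ℚ̄/k)` with `τζ = ζ^c`, multiplication by `c`
  is a bijection of it; hence `τ(N_k(1 − ζ^a)) = N_k(1 − ζ^a)` (reindex the `finprod`) and ★ `sinnottNorm_mem : N_k(1 − ζ^a) ∈ k`
  (infinite Galois correspondence `InfiniteGalois.fixedField_fixingSubgroup` for `ℚ̄/ℚ`).
* §2 `1 − μ` is a unit of the algebraic integers for `μ` a primitive `t`-th root of unity, `t` not a prime power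
  (`∏_{μ primitive} (1 − μ) = Φ_t(1) = 1`, Mathlib `eval_one_cyclotomic_not_prime_pow` +
  `cyclotomic_eq_prod_X_sub_primitiveRoots`): `exists_integral_mul_one_sub_eq_one`; hence `N_k(1 − ζ^a)` is an algebraic
  integer with an algebraic-integer inverse (`isIntegral_sinnottNorm`, `exists_integral_mul_sinnottNorm_eq_one`).
* §3 ★ `exists_globalUnit_eq_sinnottNorm : ∃ u ∈ globalUnitsOf k, (u : ℚ̄) = sinnottNorm k ζ a` (`t` not a prime power,
  `(a, t) = 1`) and the tower form ★ `exists_globalUnits_eq_sinnottNorm` along `K_n = cyclotomicLayer F₀ p n` with a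
  compatible root system of levels `p^{n+1} m`, `m ≥ 2` prime to `p`.

## References
* T. Tsuji, J. Number Theory 78 (1999) §6 (p. 20: `D_k`, `C_k = D_k ∩ E_k`). [Tsuji1999]
* S. Lang, *Cyclotomic Fields I and II* (1990), Ch. 3 §5 (PDF pp. 70–71: cyclotomic units). [Lang1990]
* L. C. Washington, *Introduction to Cyclotomic Fields* (1997), Prop. 2.8 (`1 − ζ_n` is a unit if `n` has two distinct
  prime factors). [Washington1997]
-/

noncomputable section

open scoped NumberField
open IsDedekindDomain Field
open Literature.NumberTheory.ComplexMultiplication.EllipticUnits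

namespace Literature.NumberTheory.IwasawaTheory

namespace CyclotomicUnits

variable (k : IntermediateField ℚ (AlgebraicClosure ℚ)) {t : ℕ}

/-! ### §1. Galois descent: `N_k(1 − ζ^a) ∈ k` -/

/-- `ζ^(m mod t) = ζ^m` for a primitive `t`-th root of unity. [cite: Lang1990, Ch. 3 §5 (PDF p. 70)] -/
theorem pow_mod_eq_pow {ζ : AlgebraicClosure ℚ} (hζ : IsPrimitiveRoot ζ t) (m : ℕ) : ζ ^ (m % t) = ζ ^ m := by
  conv_lhs => rw [hζ.eq_orderOf]
  exact pow_mod_orderOf ζ m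

/-- `sinnottExponents k ζ` is closed under multiplication (compose the witnessing automorphisms).
[cite: Tsuji1999, §6 (p. 20, «Gal(ℚ(μ_t)/ℚ(μ_t) ∩ k)»)] -/
theorem mul_mem_sinnottExponents {ζ : AlgebraicClosure ℚ} (hζ : IsPrimitiveRoot ζ t) {b c : ZMod t}
    (hb : b ∈ sinnottExponents (t := t) k ζ) (hc : c ∈ sinnottExponents (t := t) k ζ) :
    c * b ∈ sinnottExponents (t := t) k ζ := by
  obtain ⟨σ, hσk, hσζ⟩ := (mem_sinnottExponents_iff k ζ b).mp hb
  obtain ⟨τ, hτk, hτζ⟩ := (mem_sinnottExponents_iff k ζ c).mp hc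
  refine (mem_sinnottExponents_iff k ζ _).mpr ⟨τ * σ, fun x hx => ?_, ?_⟩
  · rw [map_mul, AlgEquiv.mul_apply, hσk x hx, hτk x hx]
  · rw [map_mul, AlgEquiv.mul_apply, hσζ, map_pow, hτζ, ← pow_mul, ZMod.val_mul, pow_mod_eq_pow hζ]

/-- An automorphism of `ℚ̄` sends a primitive `t`-th root of unity `ζ` to `ζ^c` for some `c` prime to `t`.
[cite: Tsuji1999, §6 (p. 20)] -/
theorem exists_apply_eq_pow (ht : 0 < t) {ζ : AlgebraicClosure ℚ} (hζ : IsPrimitiveRoot ζ t)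
    (τ : AlgebraicClosure ℚ ≃ₐ[ℚ] AlgebraicClosure ℚ) : ∃ c : ℕ, c < t ∧ c.Coprime t ∧ τ ζ = ζ ^ c := by
  haveI : NeZero t := ⟨ht.ne'⟩
  have h1 : (τ ζ) ^ t = 1 := by rw [← map_pow, hζ.pow_eq_one, map_one]
  obtain ⟨c, hct, hc⟩ := hζ.eq_pow_of_pow_eq_one h1
  refine ⟨c, hct, ?_, hc.symm⟩
  have hprim : IsPrimitiveRoot (τ ζ) t := hζ.map_of_injective τ.injective
  rw [← hc] at hprim
  exact (hζ.pow_iff_coprime ht c).mp hprim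

/-- **`τ(N_k(1 − ζ^a)) = N_k(1 − ζ^a)` for every `τ` fixing `k` pointwise** (reindex `b ↦ cb`, `τζ = ζ^c`, a bijection of
`sinnottExponents k ζ`). [cite: Tsuji1999, §6 (p. 20)] -/
theorem apply_sinnottNorm_of_fixing (ht : 0 < t) {ζ : AlgebraicClosure ℚ} (hζ : IsPrimitiveRoot ζ t) (a : ℕ)
    (τ : AlgebraicClosure ℚ ≃ₐ[ℚ] AlgebraicClosure ℚ) (hτ : ∀ x : AlgebraicClosure ℚ, x ∈ k → τ x = x) :
    τ (sinnottNorm (t := t) k ζ a) = sinnottNorm (t := t) k ζ a := by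
  haveI : NeZero t := ⟨ht.ne'⟩
  obtain ⟨c, hct, hcop, hc⟩ := exists_apply_eq_pow ht hζ τ
  -- `c ∈ sinnottExponents k ζ`, witnessed by `τ`
  have hcS : (c : ZMod t) ∈ sinnottExponents (t := t) k ζ := by
    refine (mem_sinnottExponents_iff k ζ _).mpr ⟨(absoluteGaloisGroup.toAlgEquiv ℚ).symm τ, fun x hx => ?_, ?_⟩
    · rw [MulEquiv.apply_symm_apply]; exact hτ x hx
    · rw [MulEquiv.apply_symm_apply, ZMod.val_natCast, Nat.mod_eq_of_lt hct]; exact hc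
  set S := sinnottExponents (t := t) k ζ with hS
  have hfin : S.Finite := Set.toFinite S
  -- multiplication by `c` is a bijection of `S`
  have hmaps : Set.MapsTo (fun b : ZMod t => (c : ZMod t) * b) S S := fun b hb => mul_mem_sinnottExponents k hζ hb hcS
  have hinj : Set.InjOn (fun b : ZMod t => (c : ZMod t) * b) S := by
    intro b _ b' _ h
    have hu : IsUnit (c : ZMod t) := (ZMod.isUnit_iff_coprime c t).mpr hcop
    exact hu.mul_left_cancel h
  have hbij : Set.BijOn (fun b : ZMod t => (c : ZMod t) * b) S S := (hfin.injOn_iff_bijOn_of_mapsTo hmaps).mp hinj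
  rw [sinnottNorm]
  have hmap := MonoidHom.map_finprod_mem (fun b : ZMod t => (1 - ζ ^ (a * b.val)))
    (τ : AlgebraicClosure ℚ →* AlgebraicClosure ℚ) hfin
  simp only [MonoidHom.coe_coe, map_sub, map_one, map_pow, hc] at hmap
  rw [hmap]
  refine finprod_mem_eq_of_bijOn (fun b : ZMod t => (c : ZMod t) * b) hbij fun b _ => ?_
  -- `(ζ^c)^(a b) = ζ^(a (c b))`
  have hval : ((c : ZMod t) * b).val = (c * b.val) % t := by
    rw [ZMod.val_mul, ZMod.val_natCast, Nat.mod_eq_of_lt hct]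
  rw [hval, ← pow_mul, ← pow_mod_eq_pow hζ (a * (c * b.val % t)), Nat.mul_mod, Nat.mod_mod, ← Nat.mul_mod,
    pow_mod_eq_pow hζ, show c * (a * b.val) = a * (c * b.val) by ring]

/-- **Sinnott's norm element lies in `k`**: `N_{ℚ(μ_t)/ℚ(μ_t)∩k}(1 − ζ^a) ∈ k` (Galois descent: it is fixed by `Gal(ℚ̄/k)`, and
`ℚ̄/ℚ` is Galois, `InfiniteGalois.fixedField_fixingSubgroup`). [cite: Tsuji1999, §6 (p. 20, «D_k … the subgroup of k^× generated by …»)] -/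
theorem sinnottNorm_mem (ht : 0 < t) {ζ : AlgebraicClosure ℚ} (hζ : IsPrimitiveRoot ζ t) (a : ℕ) :
    sinnottNorm (t := t) k ζ a ∈ k := by
  have hG := @IsAlgClosure.isGalois ℚ (AlgebraicClosure ℚ) _ _ (AlgebraicClosure.instAlgebra ℚ)
    (inferInstance : @IsAlgClosure ℚ (AlgebraicClosure ℚ) _ _ (AlgebraicClosure.instAlgebra ℚ) _) _
  have h := @InfiniteGalois.fixedField_fixingSubgroup ℚ (AlgebraicClosure ℚ) _ _ _ k hG
  have hmem : sinnottNorm (t := t) k ζ a ∈ IntermediateField.fixedField k.fixingSubgroup := by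
    rw [IntermediateField.mem_fixedField_iff]
    intro τ hτ
    exact apply_sinnottNorm_of_fixing k ht hζ a τ ((IntermediateField.mem_fixingSubgroup_iff _ _).mp hτ)
  rwa [h] at hmem

/-! ### §2. Integrality and invertibility: `Φ_t(1) = 1` for `t` not a prime power -/

/-- `1 − ζ^m` is an algebraic integer for a root of unity `ζ`. [cite: Lang1990, Ch. 3 §5 (PDF p. 70)] -/
theorem isIntegral_one_sub_pow (ht : 0 < t) {ζ : AlgebraicClosure ℚ} (hζ : IsPrimitiveRoot ζ t) (m : ℕ) :
    IsIntegral ℤ (1 - ζ ^ m) :=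
  isIntegral_one.sub ((hζ.isIntegral ht).pow m)

/-- **`N_k(1 − ζ^a)` is an algebraic integer.** [cite: Tsuji1999, §6 (p. 20, C_k = D_k ∩ E_k)] -/
theorem isIntegral_sinnottNorm (ht : 0 < t) {ζ : AlgebraicClosure ℚ} (hζ : IsPrimitiveRoot ζ t) (a : ℕ) :
    IsIntegral ℤ (sinnottNorm (t := t) k ζ a) := by
  rw [sinnottNorm]
  exact finprod_mem_induction (IsIntegral ℤ) isIntegral_one (fun _ _ hx hy => hx.mul hy)
    fun b _ => isIntegral_one_sub_pow ht hζ _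

/-- **For `t` not a prime power and `μ` a primitive `t`-th root of unity, `1 − μ` is a unit of the algebraic integers**:
there is an algebraic integer `y` with `(1 − μ)·y = 1` (`y = ∏_{μ' ≠ μ primitive} (1 − μ')`, since `∏ (1 − μ') = Φ_t(1) = 1`).
[cite: Washington1997, Prop. 2.8] [cite: Lang1990, Ch. 3 §5 (PDF pp. 70–71)] -/
theorem exists_integral_mul_one_sub_eq_one (ht : ∀ {q : ℕ}, q.Prime → ∀ j : ℕ, q ^ j ≠ t) (ht0 : 0 < t)
    {μ : AlgebraicClosure ℚ} (hμ : IsPrimitiveRoot μ t) : ∃ y : AlgebraicClosure ℚ, IsIntegral ℤ y ∧ (1 - μ) * y = 1 := by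
  classical
  have hprod : ∏ μ' ∈ primitiveRoots t (AlgebraicClosure ℚ), (1 - μ') = 1 := by
    have h1 := Polynomial.eval_one_cyclotomic_not_prime_pow (R := AlgebraicClosure ℚ) ht
    rw [Polynomial.cyclotomic_eq_prod_X_sub_primitiveRoots hμ, Polynomial.eval_prod] at h1
    simpa only [Polynomial.eval_sub, Polynomial.eval_X, Polynomial.eval_C] using h1
  have hmem : μ ∈ primitiveRoots t (AlgebraicClosure ℚ) := (mem_primitiveRoots ht0).mpr hμ
  refine ⟨∏ μ' ∈ (primitiveRoots t (AlgebraicClosure ℚ)).erase μ, (1 - μ'), ?_, ?_⟩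
  · refine IsIntegral.prod _ fun μ' hμ' => ?_
    have hμ'p : IsPrimitiveRoot μ' t := (mem_primitiveRoots ht0).mp (Finset.mem_of_mem_erase hμ')
    simpa using isIntegral_one_sub_pow ht0 hμ'p 1
  · rw [Finset.mul_prod_erase _ _ hmem, hprod]

/-- **`N_k(1 − ζ^a)` is invertible in the algebraic integers** for `t` not a prime power and `(a, t) = 1` (each factor
`1 − ζ^{ab}`, `b` prime to `t`, is). [cite: Washington1997, Prop. 2.8] [cite: Tsuji1999, §6 (p. 20)] -/
theorem exists_integral_mul_sinnottNorm_eq_one (ht : ∀ {q : ℕ}, q.Prime → ∀ j : ℕ, q ^ j ≠ t) (ht1 : 1 < t)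
    {ζ : AlgebraicClosure ℚ} (hζ : IsPrimitiveRoot ζ t) {a : ℕ} (ha : a.Coprime t) :
    ∃ y : AlgebraicClosure ℚ, IsIntegral ℤ y ∧ sinnottNorm (t := t) k ζ a * y = 1 := by
  haveI : NeZero t := ⟨by omega⟩
  rw [sinnottNorm]
  refine finprod_mem_induction (fun x => ∃ y : AlgebraicClosure ℚ, IsIntegral ℤ y ∧ x * y = 1) ⟨1, isIntegral_one, by simp⟩
    (fun x x' ⟨y, hy, hxy⟩ ⟨y', hy', hxy'⟩ => ⟨y * y', hy.mul hy', by
      calc x * x' * (y * y') = (x * y) * (x' * y') := by ring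
        _ = 1 := by rw [hxy, hxy', one_mul]⟩) fun b hb => ?_
  -- `ζ^{a b}` is primitive: `a`, `b` prime to `t`
  obtain ⟨σ, -, hσζ⟩ := (mem_sinnottExponents_iff k ζ b).mp hb
  obtain ⟨c, hct, hcop, hc⟩ := exists_apply_eq_pow ht1.le hζ (absoluteGaloisGroup.toAlgEquiv ℚ σ)
  have hbval : b.val = c := hζ.pow_inj (ZMod.val_lt b) hct (hσζ.symm.trans hc)
  have hprim : IsPrimitiveRoot (ζ ^ (a * b.val)) t := by
    rw [hbval]
    exact hζ.pow_of_coprime _ (Nat.Coprime.mul_left ha hcop)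
  exact exists_integral_mul_one_sub_eq_one ht (by omega) hprim

/-! ### §3. Packaging: a global unit of `k` with the value `N_k(1 − ζ^a)`; the tower form -/

/-- **Sinnott's norm element IS a global unit of `k`**: for `t` not a prime power, `ζ` a primitive `t`-th root of unity and
`(a, t) = 1` there is `u ∈ E_k = globalUnitsOf k` with value `N_{ℚ(μ_t)/ℚ(μ_t)∩k}(1 − ζ^a)`.
[cite: Tsuji1999, §6 (p. 20, «C_k = D_k ∩ E_k»)] [cite: Washington1997, Prop. 2.8] -/
theorem exists_globalUnit_eq_sinnottNorm (ht : ∀ {q : ℕ}, q.Prime → ∀ j : ℕ, q ^ j ≠ t) (ht1 : 1 < t)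
    {ζ : AlgebraicClosure ℚ} (hζ : IsPrimitiveRoot ζ t) {a : ℕ} (ha : a.Coprime t) :
    ∃ u : (AlgebraicClosure ℚ)ˣ, u ∈ globalUnitsOf k ∧ (u : AlgebraicClosure ℚ) = sinnottNorm (t := t) k ζ a := by
  obtain ⟨y, hy, hxy⟩ := exists_integral_mul_sinnottNorm_eq_one k ht ht1 hζ ha
  refine ⟨Units.mkOfMulEqOne _ _ hxy, ⟨?_, ?_, ?_⟩, rfl⟩
  · exact isIntegral_sinnottNorm k (by omega) hζ a
  · exact hy
  · exact sinnottNorm_mem k (by omega) hζ a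

/-- `p^{n+1}·m` is not a prime power when `m ≥ 2` is prime to `p`. [cite: Washington1997, Prop. 2.8 (hypothesis)] -/
theorem pow_ne_prime_pow_mul {p : ℕ} (hp : p.Prime) {m : ℕ} (hm : 2 ≤ m) (hmp : m.Coprime p) (n : ℕ) :
    ∀ {q : ℕ}, q.Prime → ∀ j : ℕ, q ^ j ≠ p ^ (n + 1) * m := by
  intro q hq j h
  have hqp : q = p := by
    have : p ∣ q ^ j := by rw [h]; exact Dvd.dvd.mul_right (dvd_pow_self p (Nat.succ_ne_zero n)) m
    exact ((Nat.prime_dvd_prime_iff_eq hp hq).mp (hp.dvd_of_dvd_pow this)).symm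
  subst hqp
  have hm' : m ∣ q ^ j := by rw [h]; exact Dvd.intro_left _ rfl
  obtain ⟨i, -, rfl⟩ := (Nat.dvd_prime_pow hq).mp hm'
  rcases i with _ | i
  · simp at hm
  · have : q ∣ q ^ (i + 1) := dvd_pow_self q (Nat.succ_ne_zero i)
    have h1 : q = 1 := Nat.Coprime.eq_one_of_dvd hmp.symm this
    exact hq.one_lt.ne' h1

/-- **The Sinnott family of a tower is a family of GLOBAL UNITS**: along `K_n = F₀(μ_{p^{n+1}})` with a compatible system
`ζ n` of primitive `p^{n+1}m`-th roots of unity (`m ≥ 2` prime to `p`), there are `ξ n ∈ E_{K_n}` with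
`ξ n = N_{ℚ(μ_{p^{n+1}m})/K_n}(1 − ζ n)` — the value pin `GenusDatum.ξu_val` of the `𝒞₇` genus road is satisfiable.
[cite: Tsuji1999, §6 (p. 20)] [cite: Washington1997, Prop. 2.8] -/
theorem exists_globalUnits_eq_sinnottNorm (F₀ : IntermediateField ℚ (AlgebraicClosure ℚ)) {p : ℕ} (hp : p.Prime) {m : ℕ}
    (hm : 2 ≤ m) (hmp : m.Coprime p) {ζ : ℕ → AlgebraicClosure ℚ} (hζ : IsCompatibleRootSystem m p ζ) :
    ∃ ξ : ∀ n : ℕ, globalUnitsOf (cyclotomicLayer F₀ p n),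
      ∀ n : ℕ, (((ξ n : globalUnitsOf (cyclotomicLayer F₀ p n)) : (AlgebraicClosure ℚ)ˣ) : AlgebraicClosure ℚ) =
        sinnottNorm (t := p ^ (n + 1) * m) (cyclotomicLayer F₀ p n) (ζ n) 1 := by
  have h : ∀ n : ℕ, ∃ u : (AlgebraicClosure ℚ)ˣ, u ∈ globalUnitsOf (cyclotomicLayer F₀ p n) ∧
      (u : AlgebraicClosure ℚ) = sinnottNorm (t := p ^ (n + 1) * m) (cyclotomicLayer F₀ p n) (ζ n) 1 := fun n =>
    exists_globalUnit_eq_sinnottNorm _ (pow_ne_prime_pow_mul hp hm hmp n)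
      (lt_of_lt_of_le (by omega : 1 < m) (Nat.le_mul_of_pos_left m (pow_pos hp.pos _))) (hζ.1 n)
      (Nat.coprime_one_left _)
  choose u hu using h
  exact ⟨fun n => ⟨u n, (hu n).1⟩, fun n => (hu n).2⟩

end CyclotomicUnits

end Literature.NumberTheory.IwasawaTheory

end
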